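/-
Width seat `ym-line-cbag-p1-w3` (prover-ym-line-cbag-p1-w3-g10-0; own items stmt-QuantumFields-22254 / 22893 CLOSED proved).  Glue towards the
TWO-SIDED six-plane DLR transfer (node `Theorems.TreeLevelLimitWitness`): the error budget of the UPPER transfer at the explicit exponents
`θ = 60A ≤ 1/200`, torus-mean excess `β^{−(1+3θ)}`, slack `β^{−9A}`.  Pure real bookkeeping; the Yang–Mills mass gap is NOT proved by anything here.
-/
import Summits.QuantumFields.YangMills.Theorems.SixPlaneColdBoxTransferBudget

/-!
# Route `SixPlaneColdBox`, glue: the error budget of the UPPER six-plane transfer (explicit exponents)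

Twin of `SixPlaneColdBox.transferBudget` for the upper half of the two-sided transfer (`SixPlaneColdBoxTransferUpper`).  With `θ = 60A ≤ 1/200`,
the torus-mean excess `β·(E_torus c − E_box c) ≤ β^{−3θ}` per plane (`torusMean_sub_boxMean_le_rpow`), the flat mean smoothness
`β^{2θ/5−1}⌈β^A⌉/⌈β^θ⌉`, the sup of the kernel-mean excess `C_S β^{2θ/5} + 4β^{−1/4}` per plane (`sixPlane_goodDatum_cov_upper`) and the bad mass
`p ≤ 6·7⁴·β^{4θ}e^{−β^{θ/5}}`, the five error pieces of the upper transfer — the integrated datum ceiling, the covariance slack `2β^{−1/5}`, the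
`σ·∫Ψ'` term and the product term of `total_covariance_upper_bound_dev`, and the bad-event term — sum to at most `β^{−9A}` eventually:

* **`transferBudgetUpper`** — the eventual inequality consumed by `SixPlaneColdBox.sixPlaneTransfer_upper`;
* `abs_dev_le`, `abs_sum_sub_sum_le_of_planes`, `integral_dev_le` — bookkeeping of the mean deviations `Ψ = β⁻¹(M⁺ + c)`;
* `transferBudgetLower60` — the budget of the LOWER transfer (`SixPlaneColdBox.transferBudget`, typed for `θ = 20A` and an existential margin)
  re-run at `θ = 60A` with the explicit torus-mean excess `β^{−(1+3θ)}` and slack `β^{−9A}`.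

No sorry; no definition; standard axioms.  NOT a claim about the Yang–Mills mass gap.
-/

set_option autoImplicit false

noncomputable section

open MeasureTheory Finset Real Filter Topology
open Summit.QuantumFields.YangMills.Theorems.WeakCouplingRates

namespace Summit.QuantumFields.YangMills.Theorems.SixPlaneColdBox

/-- Monotonicity of `β ↦ β^a` in the exponent for `β ≥ 1`, with a nonnegative constant. -/
theorem const_mul_rpow_le_const_mul_rpow {C β a b : ℝ} (hC : 0 ≤ C) (hβ : 1 ≤ β) (hab : a ≤ b) : C * β ^ a ≤ C * β ^ b :=
  mul_le_mul_of_nonneg_left (Real.rpow_le_rpow_of_exponent_le hβ hab) hC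

set_option maxHeartbeats 400000 in
/-- **The error budget of the UPPER transfer.**  With `θ = 60A ≤ 1/200` and nonnegative constants, eventually in `β`: for every
`0 ≤ p ≤ 6·2401·β^{4θ}e^{−β^{θ/5}}` the five error pieces sum to at most `β^{−9A}` (notation of `SixPlaneColdBox.sixPlaneTransfer_upper`:
`BM = β·(cP·β^{−(1+3θ)}) + cP·2β^{−1/4}`, `BM' = β·(cP·β^{−(1+3θ)} + SKf·β^{2θ/5−1}⌈β^A⌉/⌈β^θ⌉) + cP·2β^{−1/4}`, `CM = βC₆ + βC₆ + 2cP`,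
`Bσ = cP·(C_S β^{2θ/5} + 4β^{−1/4}) + cP·2β^{−1/4}`). -/
theorem transferBudgetUpper {A θ K cP SKf CS C₆ : ℝ} (hA : 0 < A) (hA60 : 60 * A = θ) (hθ2 : θ ≤ 1 / 200)
    (hK : 0 ≤ K) (hcP : 0 ≤ cP) (hSKf : 0 ≤ SKf) (hCS : 0 ≤ CS) (hC₆ : 0 ≤ C₆) :
    ∀ᶠ β : ℝ in atTop, ∀ p : ℝ, 0 ≤ p → p ≤ 6 * 2401 * (β ^ (4 * θ) * Real.exp (-(β ^ (θ / 5)))) →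
      K * β ^ (-(4 * A)) * cP *
            ((β * (cP * β ^ (-(1 + 3 * θ))) + cP * (2 * β ^ (-(1 / 4 : ℝ)))) +
              (β * (cP * β ^ (-(1 + 3 * θ)) + SKf * (β ^ (2 * (θ / 5) - 1) * (⌈β ^ A⌉₊ : ℝ) / (⌈β ^ θ⌉₊ : ℝ))) +
                cP * (2 * β ^ (-(1 / 4 : ℝ)))) +
              2 * (β * C₆ + β * C₆ + cP * 2) * p) +
          cP ^ 2 * (2 * β ^ (-(1 / 5 : ℝ))) +
          (cP * (CS * β ^ (2 * (θ / 5)) + 4 * β ^ (-(1 / 4 : ℝ))) + cP * (2 * β ^ (-(1 / 4 : ℝ)))) *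
            ((β * (cP * β ^ (-(1 + 3 * θ)) + SKf * (β ^ (2 * (θ / 5) - 1) * (⌈β ^ A⌉₊ : ℝ) / (⌈β ^ θ⌉₊ : ℝ))) +
                cP * (2 * β ^ (-(1 / 4 : ℝ)))) +
              (β * C₆ + β * C₆ + cP * 2) * p + cP * (2 * β ^ (-(1 / 4 : ℝ)))) +
          ((β * (cP * β ^ (-(1 + 3 * θ))) + cP * (2 * β ^ (-(1 / 4 : ℝ)))) + (β * C₆ + β * C₆ + cP * 2) * p +
              cP * (2 * β ^ (-(1 / 4 : ℝ))) + 2 * (β * C₆) * p) *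
            ((β * (cP * β ^ (-(1 + 3 * θ)) + SKf * (β ^ (2 * (θ / 5) - 1) * (⌈β ^ A⌉₊ : ℝ) / (⌈β ^ θ⌉₊ : ℝ))) +
                cP * (2 * β ^ (-(1 / 4 : ℝ)))) + (β * C₆ + β * C₆ + cP * 2) * p +
              cP * (2 * β ^ (-(1 / 4 : ℝ))) + 2 * (β * C₆) * p) +
          β ^ 2 * ((2 * C₆ ^ 2 + 6 * C₆ ^ 2) * p) ≤ β ^ (-(9 * A)) := by
  have hθ : 0 < θ := by linarith
  have hδ : (0 : ℝ) < θ / 5 := by positivity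
  -- the common small power `ε = β^{A − 3θ/5}` and the exponent gaps (`θ = 60A`)
  have hε_neg : A - 3 * (θ / 5) < 0 := by linarith
  have hgap1 : -(4 * A) + (A - 3 * (θ / 5)) < -(9 * A) := by linarith
  have hgap2 : 2 * (θ / 5) + (A - 3 * (θ / 5)) < -(9 * A) := by linarith
  have hgap3 : (A - 3 * (θ / 5)) + (A - 3 * (θ / 5)) < -(9 * A) := by linarith
  have hgap4 : -(1 / 5 : ℝ) < -(9 * A) := by linarith
  have h5 : (0 : ℝ) < 5 := by norm_num
  filter_upwards [eventually_const_rpow_le_rpow_div (C := K * cP * (6 * cP + 2 * SKf + 2)) hgap1 h5,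
    eventually_const_rpow_le_rpow_div (C := (cP * CS + 6 * cP) * (5 * cP + 2 * SKf + 1)) hgap2 h5,
    eventually_const_rpow_le_rpow_div (C := (5 * cP + 2) * (5 * cP + 2 * SKf + 2)) hgap3 h5,
    eventually_const_rpow_le_rpow_div (C := cP ^ 2 * 2) hgap4 h5,
    eventually_const_rpow_exp_le_rpow_div (C := 8 * C₆ ^ 2 * (6 * 2401)) (s := 2 + 4 * θ) (b := -(9 * A)) hδ h5,
    eventually_const_rpow_exp_le_rpow_div (C := (2 * C₆ + 2 * cP + 2 * C₆) * (6 * 2401)) (s := 1 + 4 * θ) (b := A - 3 * (θ / 5)) hδ one_pos,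
    eventually_ge_atTop (1 : ℝ)] with β e1 e2 e3 e4 e5 e6 hβ1
  intro p hp0 hp_le
  have hβ0 : 0 < β := by linarith
  -- ### atoms
  set ε : ℝ := β ^ (A - 3 * (θ / 5)) with hε
  set X : ℝ := β * (cP * β ^ (-(1 + 3 * θ))) with hX
  set Y : ℝ := cP * (2 * β ^ (-(1 / 4 : ℝ))) with hY
  set Z : ℝ := β * (cP * β ^ (-(1 + 3 * θ)) + SKf * (β ^ (2 * (θ / 5) - 1) * (⌈β ^ A⌉₊ : ℝ) / (⌈β ^ θ⌉₊ : ℝ))) with hZ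
  set CM : ℝ := β * C₆ + β * C₆ + cP * 2 with hCM
  set Bs : ℝ := cP * (CS * β ^ (2 * (θ / 5)) + 4 * β ^ (-(1 / 4 : ℝ))) + cP * (2 * β ^ (-(1 / 4 : ℝ))) with hBs
  have hε0 : 0 < ε := Real.rpow_pos_of_pos hβ0 _
  have hX0 : 0 ≤ X := by rw [hX]; positivity
  have hY0 : 0 ≤ Y := by rw [hY]; positivity
  have hZ0 : 0 ≤ Z := by rw [hZ]; positivity
  have hCM0 : 0 ≤ CM := by rw [hCM]; positivity
  have hBs0 : 0 ≤ Bs := by rw [hBs]; positivity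
  -- ### the atoms against `ε`
  have hexc : X ≤ cP * ε := by
    have epow : β * β ^ (-(1 + 3 * θ)) = β ^ (-(3 * θ)) := by
      rw [← Real.rpow_one_add' hβ0.le (by linarith : (1 : ℝ) + -(1 + 3 * θ) ≠ 0)]; ring_nf
    calc X = cP * (β * β ^ (-(1 + 3 * θ))) := by rw [hX]; ring
      _ = cP * β ^ (-(3 * θ)) := by rw [epow]
      _ ≤ cP * ε := const_mul_rpow_le_const_mul_rpow hcP hβ1 (by linarith)
  have h14 : Y ≤ 2 * cP * ε := by
    calc Y = (2 * cP) * β ^ (-(1 / 4 : ℝ)) := by rw [hY]; ring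
      _ ≤ (2 * cP) * ε := const_mul_rpow_le_const_mul_rpow (by positivity) hβ1 (by linarith)
  have hTH : (⌈β ^ A⌉₊ : ℝ) / (⌈β ^ θ⌉₊ : ℝ) ≤ 2 * β ^ (A - θ) := ceil_div_ceil_le_rpow hβ1 hA.le
  have hflat : β * (SKf * (β ^ (2 * (θ / 5) - 1) * (⌈β ^ A⌉₊ : ℝ) / (⌈β ^ θ⌉₊ : ℝ))) ≤ 2 * SKf * ε := by
    have epow : β * β ^ (2 * (θ / 5) - 1) = β ^ (2 * (θ / 5)) := by
      rw [← Real.rpow_one_add' hβ0.le (by linarith : (1 : ℝ) + (2 * (θ / 5) - 1) ≠ 0)]; ring_nf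
    have eε : β ^ (2 * (θ / 5)) * β ^ (A - θ) = ε := by
      rw [hε, ← Real.rpow_add hβ0]; ring_nf
    calc β * (SKf * (β ^ (2 * (θ / 5) - 1) * (⌈β ^ A⌉₊ : ℝ) / (⌈β ^ θ⌉₊ : ℝ)))
        = SKf * (β * β ^ (2 * (θ / 5) - 1)) * ((⌈β ^ A⌉₊ : ℝ) / (⌈β ^ θ⌉₊ : ℝ)) := by ring
      _ = SKf * β ^ (2 * (θ / 5)) * ((⌈β ^ A⌉₊ : ℝ) / (⌈β ^ θ⌉₊ : ℝ)) := by rw [epow]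
      _ ≤ SKf * β ^ (2 * (θ / 5)) * (2 * β ^ (A - θ)) := mul_le_mul_of_nonneg_left hTH (by positivity)
      _ = 2 * SKf * (β ^ (2 * (θ / 5)) * β ^ (A - θ)) := by ring
      _ = 2 * SKf * ε := by rw [eε]
  have hZle : Z ≤ (cP + 2 * SKf) * ε := by
    have e : Z = X + β * (SKf * (β ^ (2 * (θ / 5) - 1) * (⌈β ^ A⌉₊ : ℝ) / (⌈β ^ θ⌉₊ : ℝ))) := by rw [hZ, hX]; ring
    rw [e]; linarith only [hexc, hflat]
  -- the bad-mass atoms: `(4C₆ + 2cP)·β·p ≤ ε`, whence `CM·p ≤ ε`, `2βC₆·p ≤ ε`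
  have hpm : (2 * C₆ + 2 * cP + 2 * C₆) * β * p ≤ ε := by
    have h1 : (2 * C₆ + 2 * cP + 2 * C₆) * β * p ≤
        (2 * C₆ + 2 * cP + 2 * C₆) * β * (6 * 2401 * (β ^ (4 * θ) * Real.exp (-(β ^ (θ / 5))))) :=
      mul_le_mul_of_nonneg_left hp_le (by positivity)
    have epow : β * β ^ (4 * θ) = β ^ (1 + 4 * θ) := by
      rw [Real.rpow_add hβ0, Real.rpow_one]
    have e : (2 * C₆ + 2 * cP + 2 * C₆) * β * (6 * 2401 * (β ^ (4 * θ) * Real.exp (-(β ^ (θ / 5))))) =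
        (2 * C₆ + 2 * cP + 2 * C₆) * (6 * 2401) * ((β * β ^ (4 * θ)) * Real.exp (-(β ^ (θ / 5)))) := by ring
    rw [e, epow] at h1
    have h2 := e6
    rw [div_one] at h2
    exact h1.trans h2
  have hCMp : CM * p ≤ ε := by
    have h1 : CM * p ≤ (2 * C₆ + 2 * cP + 2 * C₆) * β * p := by
      have : CM ≤ (2 * C₆ + 2 * cP + 2 * C₆) * β := by rw [hCM]; nlinarith
      exact mul_le_mul_of_nonneg_right this hp0
    exact h1.trans hpm
  have h2C₆p : 2 * (β * C₆) * p ≤ ε := by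
    have h1 : 2 * (β * C₆) * p ≤ (2 * C₆ + 2 * cP + 2 * C₆) * β * p := by
      have : 2 * (β * C₆) ≤ (2 * C₆ + 2 * cP + 2 * C₆) * β := by nlinarith
      exact mul_le_mul_of_nonneg_right this hp0
    exact h1.trans hpm
  have hCMp0 : 0 ≤ CM * p := mul_nonneg hCM0 hp0
  have hC₆p0 : 0 ≤ 2 * (β * C₆) * p := by positivity
  -- ### the composite quantities against `ε`
  have hS1 : (X + Y) + (Z + Y) + 2 * CM * p ≤ (6 * cP + 2 * SKf + 2) * ε := by
    have e : 2 * CM * p = 2 * (CM * p) := by ring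
    rw [e]; linarith only [hexc, h14, hZle, hCMp]
  have hS2 : (Z + Y) + CM * p + Y ≤ (5 * cP + 2 * SKf + 1) * ε := by linarith only [h14, hZle, hCMp]
  have hF1 : (X + Y) + CM * p + Y + 2 * (β * C₆) * p ≤ (5 * cP + 2) * ε := by linarith only [hexc, h14, hCMp, h2C₆p]
  have hF2 : (Z + Y) + CM * p + Y + 2 * (β * C₆) * p ≤ (5 * cP + 2 * SKf + 2) * ε := by linarith only [h14, hZle, hCMp, h2C₆p]
  have hS20 : 0 ≤ (Z + Y) + CM * p + Y := by linarith only [hZ0, hY0, hCMp0]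
  have hF20 : 0 ≤ (Z + Y) + CM * p + Y + 2 * (β * C₆) * p := by linarith only [hZ0, hY0, hCMp0, hC₆p0]
  -- the sup factor: `Bs ≤ (cP·CS + 6cP)·β^{2θ/5}`
  have hBσ : Bs ≤ (cP * CS + 6 * cP) * β ^ (2 * (θ / 5)) := by
    have h1 : cP * β ^ (-(1 / 4 : ℝ)) ≤ cP * β ^ (2 * (θ / 5)) := const_mul_rpow_le_const_mul_rpow hcP hβ1 (by linarith)
    have e : Bs = cP * CS * β ^ (2 * (θ / 5)) + 6 * (cP * β ^ (-(1 / 4 : ℝ))) := by rw [hBs]; ring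
    have e2 : (cP * CS + 6 * cP) * β ^ (2 * (θ / 5)) = cP * CS * β ^ (2 * (θ / 5)) + 6 * (cP * β ^ (2 * (θ / 5))) := by ring
    rw [e, e2]; linarith [h1]
  -- ### the five pieces against `β^{-9A}/5`
  have hP1 : K * β ^ (-(4 * A)) * cP * ((X + Y) + (Z + Y) + 2 * CM * p) ≤ β ^ (-(9 * A)) / 5 := by
    have h0 : 0 ≤ K * β ^ (-(4 * A)) * cP := by positivity
    calc _ ≤ K * β ^ (-(4 * A)) * cP * ((6 * cP + 2 * SKf + 2) * ε) := mul_le_mul_of_nonneg_left hS1 h0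
      _ = (K * cP * (6 * cP + 2 * SKf + 2)) * (β ^ (-(4 * A)) * ε) := by ring
      _ = (K * cP * (6 * cP + 2 * SKf + 2)) * β ^ (-(4 * A) + (A - 3 * (θ / 5))) := by rw [hε, ← Real.rpow_add hβ0]
      _ ≤ β ^ (-(9 * A)) / 5 := e1
  have hP2 : cP ^ 2 * (2 * β ^ (-(1 / 5 : ℝ))) ≤ β ^ (-(9 * A)) / 5 := by
    calc cP ^ 2 * (2 * β ^ (-(1 / 5 : ℝ))) = (cP ^ 2 * 2) * β ^ (-(1 / 5 : ℝ)) := by ring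
      _ ≤ β ^ (-(9 * A)) / 5 := e4
  have hP3 : Bs * ((Z + Y) + CM * p + Y) ≤ β ^ (-(9 * A)) / 5 := by
    calc _ ≤ ((cP * CS + 6 * cP) * β ^ (2 * (θ / 5))) * ((5 * cP + 2 * SKf + 1) * ε) := mul_le_mul hBσ hS2 hS20 (by positivity)
      _ = ((cP * CS + 6 * cP) * (5 * cP + 2 * SKf + 1)) * (β ^ (2 * (θ / 5)) * ε) := by ring
      _ = ((cP * CS + 6 * cP) * (5 * cP + 2 * SKf + 1)) * β ^ (2 * (θ / 5) + (A - 3 * (θ / 5))) := by rw [hε, ← Real.rpow_add hβ0]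
      _ ≤ β ^ (-(9 * A)) / 5 := e2
  have hP4 : ((X + Y) + CM * p + Y + 2 * (β * C₆) * p) * ((Z + Y) + CM * p + Y + 2 * (β * C₆) * p) ≤ β ^ (-(9 * A)) / 5 := by
    calc _ ≤ ((5 * cP + 2) * ε) * ((5 * cP + 2 * SKf + 2) * ε) := mul_le_mul hF1 hF2 hF20 (by positivity)
      _ = ((5 * cP + 2) * (5 * cP + 2 * SKf + 2)) * (ε * ε) := by ring
      _ = ((5 * cP + 2) * (5 * cP + 2 * SKf + 2)) * β ^ ((A - 3 * (θ / 5)) + (A - 3 * (θ / 5))) := by rw [hε, ← Real.rpow_add hβ0]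
      _ ≤ β ^ (-(9 * A)) / 5 := e3
  have hP5 : β ^ 2 * ((2 * C₆ ^ 2 + 6 * C₆ ^ 2) * p) ≤ β ^ (-(9 * A)) / 5 := by
    have e2' : β ^ 2 * β ^ (4 * θ) = β ^ (2 + 4 * θ) := by
      rw [← Real.rpow_natCast β 2, ← Real.rpow_add hβ0]; norm_num
    calc β ^ 2 * ((2 * C₆ ^ 2 + 6 * C₆ ^ 2) * p) ≤ β ^ 2 * ((2 * C₆ ^ 2 + 6 * C₆ ^ 2) * (6 * 2401 * (β ^ (4 * θ) * Real.exp (-(β ^ (θ / 5)))))) := by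
          gcongr
      _ = (8 * C₆ ^ 2 * (6 * 2401)) * ((β ^ 2 * β ^ (4 * θ)) * Real.exp (-(β ^ (θ / 5)))) := by ring
      _ = (8 * C₆ ^ 2 * (6 * 2401)) * (β ^ (2 + 4 * θ) * Real.exp (-(β ^ (θ / 5)))) := by rw [e2']
      _ ≤ β ^ (-(9 * A)) / 5 := e5
  have hX9 : 0 ≤ β ^ (-(9 * A)) := by positivity
  have e2CM : 2 * CM * p = 2 * (CM * p) := by ring
  rw [e2CM] at hP1 ⊢
  linarith only [hP1, hP2, hP3, hP4, hP5, hX9]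

/-! ## Bookkeeping for the deviations `Ψ`, `Ψ'` of the upper transfer -/

/-- `|β⁻¹·(max x 0 + c)| ≤ β⁻¹·(C + c)` for `|x| ≤ C`, `0 ≤ c`, `0 < β`. -/
theorem abs_dev_le {x C c β : ℝ} (hx : |x| ≤ C) (hc : 0 ≤ c) (hβ : 0 < β) : |β⁻¹ * (max x 0 + c)| ≤ β⁻¹ * (C + c) := by
  have hmax : max x 0 ≤ C := max_le ((le_abs_self x).trans hx) ((abs_nonneg x).trans hx)
  have h0 : 0 ≤ β⁻¹ * (max x 0 + c) := mul_nonneg (inv_nonneg.2 hβ.le) (add_nonneg (le_max_right _ _) hc)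
  rw [abs_of_nonneg h0]
  exact mul_le_mul_of_nonneg_left (by linarith) (inv_nonneg.2 hβ.le)

/-- Summed per-plane mean deviations: if `|β aq − β bq| ≤ (β aq − β bq + e) + e` for every plane, then
`|Σ aq − Σ bq| ≤ β⁻¹·(Σ (β aq − β bq + e) + card·e)` (`β > 0`). -/
theorem abs_sum_sub_sum_le_of_planes {ι : Type*} [Fintype ι] {β e : ℝ} (hβ : 0 < β) (a b : ι → ℝ)
    (hq : ∀ q, |β * a q - β * b q| ≤ (β * a q - β * b q + e) + e) :
    |(∑ q, a q) - ∑ q, b q| ≤ β⁻¹ * ((∑ q, (β * a q - β * b q + e)) + (Fintype.card ι : ℝ) * e) := by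
  have h1 : |∑ q, (β * a q - β * b q)| ≤ ∑ q, ((β * a q - β * b q + e) + e) :=
    (Finset.abs_sum_le_sum_abs _ _).trans (Finset.sum_le_sum fun q _ => hq q)
  have e1 : ∑ q, (β * a q - β * b q) = β * ((∑ q, a q) - ∑ q, b q) := by
    rw [Finset.sum_sub_distrib, ← Finset.mul_sum, ← Finset.mul_sum, mul_sub]
  have e2 : ∑ q, ((β * a q - β * b q + e) + e) = (∑ q, (β * a q - β * b q + e)) + (Fintype.card ι : ℝ) * e := by
    rw [Finset.sum_add_distrib, Finset.sum_const, Finset.card_univ, nsmul_eq_mul]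
  rw [e1, e2, abs_mul, abs_of_pos hβ] at h1
  have h2 := (le_div_iff₀' hβ).2 h1
  rwa [div_eq_inv_mul] at h2

/-- Integrating a deviation `β⁻¹·(max f 0 + c)`: if `f ≥ 0` off `E`, `|f| ≤ C` and `μ(E) ≤ p` (probability measure), then
`∫ β⁻¹·(max f 0 + c) ≤ β⁻¹·(∫f + C·p + c)`. -/
theorem integral_dev_le {Ω : Type*} [MeasurableSpace Ω] {μ : Measure Ω} [IsProbabilityMeasure μ] {E : Set Ω} (hE : MeasurableSet E)
    {f : Ω → ℝ} (hfi : Integrable f μ) {C c β p : ℝ} (hβ : 0 < β) (hC : 0 ≤ C) (hfnn : ∀ ω, ω ∉ E → 0 ≤ f ω) (hfC : ∀ ω, |f ω| ≤ C)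
    (hgi : Integrable (fun ω => β⁻¹ * (max (f ω) 0 + c)) μ) (hμE : μ.real E ≤ p) :
    ∫ ω, β⁻¹ * (max (f ω) 0 + c) ∂μ ≤ β⁻¹ * ((∫ ω, f ω ∂μ) + C * p + c) := by
  have hindi : Integrable (fun ω => E.indicator (fun _ => (1 : ℝ)) ω) μ := (integrable_const 1).indicator hE
  have hpt : ∀ ω, β⁻¹ * (max (f ω) 0 + c) ≤ β⁻¹ * (f ω + C * E.indicator (fun _ => (1 : ℝ)) ω + c) := fun ω =>
    mul_le_mul_of_nonneg_left (by linarith [max_zero_le_add_indicator E hfnn hfC ω]) (inv_nonneg.2 hβ.le)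
  have hindc : Integrable (fun ω => C * E.indicator (fun _ => (1 : ℝ)) ω) μ := hindi.const_mul _
  have hfa : Integrable (fun ω => f ω + C * E.indicator (fun _ => (1 : ℝ)) ω) μ := hfi.add hindc
  have hRi' : Integrable (fun ω => f ω + C * E.indicator (fun _ => (1 : ℝ)) ω + c) μ := hfa.add (integrable_const _)
  refine (integral_mono hgi (hRi'.const_mul _) hpt).trans ?_
  rw [integral_const_mul, integral_add hfa (integrable_const _), integral_add hfi hindc, integral_const_mul,
    integral_indicator_const _ hE, integral_const]
  simp only [smul_eq_mul, mul_one, probReal_univ, one_mul]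
  exact mul_le_mul_of_nonneg_left (by nlinarith [hμE, hC]) (inv_nonneg.2 hβ.le)

/-! ## The error budget of the LOWER transfer at the same exponents -/

/-- **The error budget of the LOWER transfer at the explicit exponents `θ = 60A`** (twin of `transferBudget`, which is typed for `θ = 20A` and an
existential torus-mean margin): with the torus-mean excess `β·cP·β^{−(1+3θ)}`, eventually in `β`, for every `0 ≤ p ≤ 6·2401·β^{4θ}e^{−β^{θ/5}}` and
`0 ≤ θ⁺ ≤ 2C₆²` the seven error pieces of `SixPlaneColdBox.sixPlaneTransfer_lower` sum to at most `β^{−9A}`. -/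
theorem transferBudgetLower60 {A θ K cP SKf Ks C₆ : ℝ} (hA : 0 < A) (hA60 : 60 * A = θ) (hθ2 : θ ≤ 1 / 200)
    (hK : 0 ≤ K) (hcP : 0 ≤ cP) (hSKf : 0 ≤ SKf) (hKs : 0 ≤ Ks) (hC₆ : 0 ≤ C₆) :
    ∀ᶠ β : ℝ in atTop, ∀ p θp : ℝ, 0 ≤ p → p ≤ 6 * 2401 * (β ^ (4 * θ) * Real.exp (-(β ^ (θ / 5)))) → 0 ≤ θp →
      θp ≤ 2 * C₆ ^ 2 →
        K * β ^ (-(4 * A)) * cP * (β * (cP * β ^ (-(1 + 3 * θ)))) * 2 +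
              K * β ^ (-(4 * A)) * cP * (cP * (2 * β ^ (-(1 / 4 : ℝ)))) * 2 +
              K * β ^ (-(4 * A)) * cP * (β * (SKf * (β ^ (2 * (θ / 5) - 1) * (⌈β ^ A⌉₊ : ℝ) / (⌈β ^ θ⌉₊ : ℝ)))) +
              K * β ^ (-(4 * A)) * cP * (2 * (β * C₆ + β * C₆ + cP * 2)) * p +
            cP ^ 2 * (2 * β ^ (-(1 / 5 : ℝ))) +
            β ^ 2 * ((Ks * β ^ (2 * (θ / 5) - 1) * (⌈β ^ A⌉₊ : ℝ) / (⌈β ^ θ⌉₊ : ℝ)) ^ 2 / 4) +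
            β ^ 2 * ((θp + 3 * C₆ ^ 2) * p) ≤ β ^ (-(9 * A)) := by
  have hθ : 0 < θ := by linarith
  have hδ : (0 : ℝ) < θ / 5 := by positivity
  have hgapA : -(4 * A) + -(3 * θ) < -(9 * A) := by linarith
  have hgapB : -(4 * A) + -(1 / 4 : ℝ) < -(9 * A) := by linarith
  have hgapC : -(4 * A) + 2 * (θ / 5) + A - θ < -(9 * A) := by linarith
  have hgapD : -(1 / 5 : ℝ) < -(9 * A) := by linarith
  have hgapE : 2 * (2 * (θ / 5) - 1 + A - θ) + 2 < -(9 * A) := by linarith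
  have h8 : (0 : ℝ) < 8 := by norm_num
  filter_upwards [eventually_const_rpow_le_rpow_div (C := K * cP * (2 * cP)) hgapA h8,
    eventually_const_rpow_le_rpow_div (C := K * cP * (4 * cP)) hgapB h8,
    eventually_const_rpow_le_rpow_div (C := K * cP * (2 * SKf)) hgapC h8,
    eventually_const_rpow_le_rpow_div (C := cP ^ 2 * 2) hgapD h8,
    eventually_const_rpow_le_rpow_div (C := Ks ^ 2) hgapE h8,
    eventually_const_rpow_exp_le_rpow_div (C := K * cP * (2 * (2 * (2 * C₆ + 2 * cP))) * (6 * 2401))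
      (s := -(4 * A) + 1 + 4 * θ) (b := -(9 * A)) hδ h8,
    eventually_const_rpow_exp_le_rpow_div (C := (5 * C₆ ^ 2) * (6 * 2401)) (s := 2 + 4 * θ) (b := -(9 * A)) hδ h8,
    eventually_ge_atTop (1 : ℝ)] with β e1 e2 e3 e4 e5 e6 e7 hβ1
  intro p θp hp0 hp_le hθp0 hθpK
  have hβ0 : 0 < β := by linarith
  have hTH : (⌈β ^ A⌉₊ : ℝ) / (⌈β ^ θ⌉₊ : ℝ) ≤ 2 * β ^ (A - θ) := ceil_div_ceil_le_rpow hβ1 hA.le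
  have hTH0 : 0 ≤ (⌈β ^ A⌉₊ : ℝ) / (⌈β ^ θ⌉₊ : ℝ) := by positivity
  have hP1 : K * β ^ (-(4 * A)) * cP * (β * (cP * β ^ (-(1 + 3 * θ)))) * 2 ≤ β ^ (-(9 * A)) / 8 := by
    have epow : β ^ (-(4 * A)) * (β * β ^ (-(1 + 3 * θ))) = β ^ (-(4 * A) + -(3 * θ)) := by
      rw [← Real.rpow_one_add' hβ0.le (by linarith : (1 : ℝ) + -(1 + 3 * θ) ≠ 0), ← Real.rpow_add hβ0]; ring_nf
    calc K * β ^ (-(4 * A)) * cP * (β * (cP * β ^ (-(1 + 3 * θ)))) * 2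
        = (K * cP * (2 * cP)) * (β ^ (-(4 * A)) * (β * β ^ (-(1 + 3 * θ)))) := by ring
      _ = (K * cP * (2 * cP)) * β ^ (-(4 * A) + -(3 * θ)) := by rw [epow]
      _ ≤ β ^ (-(9 * A)) / 8 := e1
  have hP2 : K * β ^ (-(4 * A)) * cP * (cP * (2 * β ^ (-(1 / 4 : ℝ)))) * 2 ≤ β ^ (-(9 * A)) / 8 := by
    calc K * β ^ (-(4 * A)) * cP * (cP * (2 * β ^ (-(1 / 4 : ℝ)))) * 2
        = (K * cP * (4 * cP)) * (β ^ (-(4 * A)) * β ^ (-(1 / 4 : ℝ))) := by ring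
      _ = (K * cP * (4 * cP)) * β ^ (-(4 * A) + -(1 / 4 : ℝ)) := by rw [← Real.rpow_add hβ0]
      _ ≤ β ^ (-(9 * A)) / 8 := e2
  have hP3 : K * β ^ (-(4 * A)) * cP * (β * (SKf * (β ^ (2 * (θ / 5) - 1) * (⌈β ^ A⌉₊ : ℝ) / (⌈β ^ θ⌉₊ : ℝ)))) ≤
      β ^ (-(9 * A)) / 8 := by
    have h1 : β * (β ^ (2 * (θ / 5) - 1) * (⌈β ^ A⌉₊ : ℝ) / (⌈β ^ θ⌉₊ : ℝ)) ≤ 2 * β ^ (2 * (θ / 5) + A - θ) := by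
      have epow : β * β ^ (2 * (θ / 5) - 1) = β ^ (2 * (θ / 5)) := by
        rw [← Real.rpow_one_add' hβ0.le (by linarith : (1 : ℝ) + (2 * (θ / 5) - 1) ≠ 0)]; ring_nf
      have e : β * (β ^ (2 * (θ / 5) - 1) * (⌈β ^ A⌉₊ : ℝ) / (⌈β ^ θ⌉₊ : ℝ)) =
          β ^ (2 * (θ / 5)) * ((⌈β ^ A⌉₊ : ℝ) / (⌈β ^ θ⌉₊ : ℝ)) := by rw [← epow]; ring
      have e2' : 2 * β ^ (2 * (θ / 5) + A - θ) = β ^ (2 * (θ / 5)) * (2 * β ^ (A - θ)) := by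
        rw [show 2 * (θ / 5) + A - θ = 2 * (θ / 5) + (A - θ) by ring, Real.rpow_add hβ0]; ring
      rw [e, e2']
      exact mul_le_mul_of_nonneg_left hTH (by positivity)
    calc K * β ^ (-(4 * A)) * cP * (β * (SKf * (β ^ (2 * (θ / 5) - 1) * (⌈β ^ A⌉₊ : ℝ) / (⌈β ^ θ⌉₊ : ℝ))))
        = K * β ^ (-(4 * A)) * cP * SKf * (β * (β ^ (2 * (θ / 5) - 1) * (⌈β ^ A⌉₊ : ℝ) / (⌈β ^ θ⌉₊ : ℝ))) := by ring
      _ ≤ K * β ^ (-(4 * A)) * cP * SKf * (2 * β ^ (2 * (θ / 5) + A - θ)) := mul_le_mul_of_nonneg_left h1 (by positivity)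
      _ = (K * cP * (2 * SKf)) * (β ^ (-(4 * A)) * β ^ (2 * (θ / 5) + A - θ)) := by ring
      _ = (K * cP * (2 * SKf)) * β ^ (-(4 * A) + 2 * (θ / 5) + A - θ) := by
          rw [← Real.rpow_add hβ0]; ring_nf
      _ ≤ β ^ (-(9 * A)) / 8 := e3
  have hP4 : cP ^ 2 * (2 * β ^ (-(1 / 5 : ℝ))) ≤ β ^ (-(9 * A)) / 8 := by
    calc cP ^ 2 * (2 * β ^ (-(1 / 5 : ℝ))) = (cP ^ 2 * 2) * β ^ (-(1 / 5 : ℝ)) := by ring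
      _ ≤ β ^ (-(9 * A)) / 8 := e4
  have hP5 : β ^ 2 * ((Ks * β ^ (2 * (θ / 5) - 1) * (⌈β ^ A⌉₊ : ℝ) / (⌈β ^ θ⌉₊ : ℝ)) ^ 2 / 4) ≤ β ^ (-(9 * A)) / 8 := by
    set x : ℝ := β ^ (2 * (θ / 5) - 1 + A - θ) with hx
    have hx0 : 0 ≤ x := by positivity
    have h1 : Ks * β ^ (2 * (θ / 5) - 1) * (⌈β ^ A⌉₊ : ℝ) / (⌈β ^ θ⌉₊ : ℝ) ≤ 2 * Ks * x := by
      have e : Ks * β ^ (2 * (θ / 5) - 1) * (⌈β ^ A⌉₊ : ℝ) / (⌈β ^ θ⌉₊ : ℝ) =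
          Ks * β ^ (2 * (θ / 5) - 1) * ((⌈β ^ A⌉₊ : ℝ) / (⌈β ^ θ⌉₊ : ℝ)) := by ring
      have ex : x = β ^ (2 * (θ / 5) - 1) * β ^ (A - θ) := by
        rw [hx, show 2 * (θ / 5) - 1 + A - θ = (2 * (θ / 5) - 1) + (A - θ) by ring, Real.rpow_add hβ0]
      rw [e, ex]
      calc Ks * β ^ (2 * (θ / 5) - 1) * ((⌈β ^ A⌉₊ : ℝ) / (⌈β ^ θ⌉₊ : ℝ)) ≤ Ks * β ^ (2 * (θ / 5) - 1) * (2 * β ^ (A - θ)) :=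
            mul_le_mul_of_nonneg_left hTH (by positivity)
        _ = 2 * Ks * (β ^ (2 * (θ / 5) - 1) * β ^ (A - θ)) := by ring
    have h0 : 0 ≤ Ks * β ^ (2 * (θ / 5) - 1) * (⌈β ^ A⌉₊ : ℝ) / (⌈β ^ θ⌉₊ : ℝ) := by positivity
    have h2 : (Ks * β ^ (2 * (θ / 5) - 1) * (⌈β ^ A⌉₊ : ℝ) / (⌈β ^ θ⌉₊ : ℝ)) ^ 2 ≤ (2 * Ks * x) ^ 2 := pow_le_pow_left₀ h0 h1 2
    have hx2 : β ^ 2 * x ^ 2 = β ^ (2 * (2 * (θ / 5) - 1 + A - θ) + 2) := by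
      rw [hx, ← Real.rpow_natCast (β ^ (2 * (θ / 5) - 1 + A - θ)) 2, ← Real.rpow_mul hβ0.le, ← Real.rpow_natCast β 2,
        ← Real.rpow_add hβ0]
      norm_num; ring_nf
    calc β ^ 2 * ((Ks * β ^ (2 * (θ / 5) - 1) * (⌈β ^ A⌉₊ : ℝ) / (⌈β ^ θ⌉₊ : ℝ)) ^ 2 / 4) ≤ β ^ 2 * ((2 * Ks * x) ^ 2 / 4) := by gcongr
      _ = Ks ^ 2 * (β ^ 2 * x ^ 2) := by ring
      _ = Ks ^ 2 * β ^ (2 * (2 * (θ / 5) - 1 + A - θ) + 2) := by rw [hx2]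
      _ ≤ β ^ (-(9 * A)) / 8 := e5
  have hP6 : K * β ^ (-(4 * A)) * cP * (2 * (β * C₆ + β * C₆ + cP * 2)) * p * 2 ≤ β ^ (-(9 * A)) / 8 := by
    have hCMle : β * C₆ + β * C₆ + cP * 2 ≤ (2 * C₆ + 2 * cP) * β := by
      have h1 : cP * 2 * 1 ≤ cP * 2 * β := mul_le_mul_of_nonneg_left hβ1 (by positivity)
      linarith
    have hCM0 : 0 ≤ β * C₆ + β * C₆ + cP * 2 := by positivity
    have h4A : β ^ (-(4 * A)) * β * β ^ (4 * θ) = β ^ (-(4 * A) + 1 + 4 * θ) := by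
      rw [Real.rpow_add hβ0, Real.rpow_add hβ0, Real.rpow_one]
    calc K * β ^ (-(4 * A)) * cP * (2 * (β * C₆ + β * C₆ + cP * 2)) * p * 2
        ≤ K * β ^ (-(4 * A)) * cP * (2 * ((2 * C₆ + 2 * cP) * β)) * (6 * 2401 * (β ^ (4 * θ) * Real.exp (-(β ^ (θ / 5))))) * 2 := by
          gcongr
      _ = (K * cP * (2 * (2 * (2 * C₆ + 2 * cP))) * (6 * 2401)) *
            ((β ^ (-(4 * A)) * β * β ^ (4 * θ)) * Real.exp (-(β ^ (θ / 5)))) := by ring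
      _ = (K * cP * (2 * (2 * (2 * C₆ + 2 * cP))) * (6 * 2401)) * (β ^ (-(4 * A) + 1 + 4 * θ) * Real.exp (-(β ^ (θ / 5)))) := by
          rw [h4A]
      _ ≤ β ^ (-(9 * A)) / 8 := e6
  have hP6' : K * β ^ (-(4 * A)) * cP * (2 * (β * C₆ + β * C₆ + cP * 2)) * p ≤ β ^ (-(9 * A)) / 8 := by
    have : 0 ≤ K * β ^ (-(4 * A)) * cP * (2 * (β * C₆ + β * C₆ + cP * 2)) * p := by positivity
    linarith only [hP6, this]
  have hP7 : β ^ 2 * ((θp + 3 * C₆ ^ 2) * p) ≤ β ^ (-(9 * A)) / 8 := by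
    have e2' : β ^ 2 * β ^ (4 * θ) = β ^ (2 + 4 * θ) := by
      rw [← Real.rpow_natCast β 2, ← Real.rpow_add hβ0]; norm_num
    calc β ^ 2 * ((θp + 3 * C₆ ^ 2) * p) ≤ β ^ 2 * ((5 * C₆ ^ 2) * (6 * 2401 * (β ^ (4 * θ) * Real.exp (-(β ^ (θ / 5)))))) := by
          gcongr
          linarith
      _ = (5 * C₆ ^ 2) * (6 * 2401) * ((β ^ 2 * β ^ (4 * θ)) * Real.exp (-(β ^ (θ / 5)))) := by ring
      _ = (5 * C₆ ^ 2) * (6 * 2401) * (β ^ (2 + 4 * θ) * Real.exp (-(β ^ (θ / 5)))) := by rw [e2']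
      _ ≤ β ^ (-(9 * A)) / 8 := e7
  have hX0 : 0 ≤ β ^ (-(9 * A)) := by positivity
  linarith only [hP1, hP2, hP3, hP4, hP5, hP6', hP7, hX0]

end Summit.QuantumFields.YangMills.Theorems.SixPlaneColdBox

end
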